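import Summits.QuantumFields.YangMills.Theorems.PoincareLipschitzSobolevL2Compactness
import Summits.QuantumFields.YangMills.Theorems.PoincareLipschitzDyadicMeansWeakLimitCube
import Summits.QuantumFields.YangMills.Theorems.PoincareLipschitzLatticeToContinuumSobolevLetters
import Summits.QuantumFields.YangMills.Theorems.PoincareLipschitzBlowDownWeakGradientLetters
import Literature.Analysis.FunctionSpaces.DiagonalWeakLimits
import HarnessLib

/-!
# Crux `BlockLipschitzL` (stmt-QuantumFields-23533) ∕ `HistoryTailL` (stmt-QuantumFields-19936), LINE 25 «CompactnessTransfer»,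
# (C)-PROOF brick (C-a3) LETTERS «EXTRACTION ON THE CUBE: `L²` BOUNDS, THE UNIT LIMIT, PAIRING LETTERS»

Cell `ym3-torus` (YM ladder rung R3 = continuum SU(2) Yang–Mills on T³ — a RUNG, NOT the Clay problem: not d = 4, not
infinite volume, not a mass gap); WIDTH helper seat `ym-ust-19936-w2` g13, (C)-PROOF lineage project (LEAD GO 13:49Z).
Helper `--supports stmt-QuantumFields-23533`; THEOREMS ONLY (0 `def`, 0 `sorry`, default heartbeats); imports: (C-a2)
✓`PoincareLipschitzSobolevL2Compactness`, ★w8's ✓`PoincareLipschitzDyadicMeansWeakLimitCube` (weak `L²` limits from dyadic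
means), px3's ✓`PoincareLipschitzLatticeToContinuumSobolevLetters` (`exists_unit_representative`, `hasWeakFDerivOn_congr_ae`),
LEAD's ✓`PoincareLipschitzBlowDownWeakGradientLetters` (`sum_smulRight_apply`), lit ✓`DiagonalWeakLimits`.

WHAT THIS FILE DOES — the continuum twin of Γ1 ⊕ Γ2-W ⊕ Γ2-IBP for sequences of maps (not blow-downs): for
`u_j : Q → S³` (`Q` the open unit cube of `ℝ³`) with weak gradients `Gs_j` on `Q` and energies `∫_Q Σ_i‖Gs_j e_i‖² ≤ Λ`,
★★★ `exists_subseq_limit_weakGrad`: a subsequence `φ`, a UNIT map `U` with weak gradient `G` on `Q`, `∫_Q Σ_i‖G e_i‖² ≤ Λ`,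
`‖u_{φ j} − U‖_{L²(Q)} → 0`, and LOWER SEMICONTINUITY of the energy on every measurable `S ⊆ Q` in the frequently-form
`(∃ᶠ j, ∫_S dens(Gs_{φ j}) ≤ M) → ∫_S dens(G) ≤ M`.  Proof: (C-a2) for the strong `L²(Q)` limit (values bounded by `1`,
`‖Gs_j‖_{L²} ≤ √Λ`); px3's unit representative; diagonal extraction of the dyadic means of the three fields `Gs_j e_i`
(lit `exists_strictMono_forall_tendsto`) and ★w8's weak limits `G_i`; `G := Σ_i proj_i ⊗ G_i`; the integration-by-parts
identity passes to the limit (strong `L²` on the left, ★w8's bounded-multiplier pairings on the right); the energy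
bounds by Cauchy–Schwarz absorption against `ψ := 𝟙_S • G_i`.

HONEST SCOPE.  Extraction only; minimality of the limit and energy convergence (the HKL transfer) are (C-b)…(C-e); nothing
of (C), (RS), S1″, S2♭″, `hHalvingBand`, `BlockLipschitzL`, `HistoryTailL` is proved here.  YM₃ on T³ is rung R3, not Clay.

References: L. Simon, Theorems on Regularity and Singularity of Energy Minimizing Maps (1996) [Simon1996] (§2.9 Lemma 1);
R. Hardt, D. Kinderlehrer, F.-H. Lin, Comm. Math. Phys. 105 (1986) 547–570 [HardtKinderlehrerLin1986]; L. C. Evans,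
Partial Differential Equations (2010) [Evans2010] (§5.7, App. D).
-/

set_option autoImplicit false

noncomputable section

open MeasureTheory Set Function Filter Topology Metric TopologicalSpace
open scoped ContDiff ENNReal RealInnerProductSpace BigOperators

namespace Summit.QuantumFields.YangMills.Theorems.PoincareLipschitzSobolevCubeExtractionLetters

open Literature.Analysis.FunctionSpaces
open Summit.QuantumFields.YangMills.Theorems.PoincareLipschitzSobolevL2Compactness
open Summit.QuantumFields.YangMills.Theorems.PoincareLipschitzDyadicMeansWeakLimitCube
open Summit.QuantumFields.YangMills.Theorems.PoincareLipschitzDyadicMeansWeakLimit (volume_openCube_lt_top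
  restrict_openCube_restrict_dyadicCell)
open Summit.QuantumFields.YangMills.Theorems.PoincareLipschitzLatticeToContinuumSobolevLetters
  (exists_unit_representative)
open Summit.QuantumFields.YangMills.Theorems.PoincareLipschitzBlowDownWeakGradientLetters (sum_smulRight_apply
  sum_smulRight_apply_single tendsto_setIntegral_norm_of_sq integrable_of_norm_le)

/-! ## §1 Letters: operator norm against the density, `L²` bound of the gradients -/

/-- **Operator norm against the standard basis**: `‖T v‖ ≤ ‖v‖·(Σ_i ‖T e_i‖²)^{1∕2}`, so `‖T‖² ≤ Σ_i ‖T e_i‖²`. [folklore] -/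
theorem opNorm_sq_le_dens {F : Type*} [NormedAddCommGroup F] [InnerProductSpace ℝ F]
    (T : EuclideanSpace ℝ (Fin 3) →L[ℝ] F) :
    ‖T‖ ^ 2 ≤ ∑ i : Fin 3, ‖T (EuclideanSpace.single i (1:ℝ))‖ ^ 2 := by
  have hD0 : 0 ≤ ∑ i : Fin 3, ‖T (EuclideanSpace.single i (1:ℝ))‖ ^ 2 := Finset.sum_nonneg fun i _ => sq_nonneg _
  have hop : ‖T‖ ≤ Real.sqrt (∑ i : Fin 3, ‖T (EuclideanSpace.single i (1:ℝ))‖ ^ 2) := by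
    refine ContinuousLinearMap.opNorm_le_bound _ (Real.sqrt_nonneg _) fun v => ?_
    have hv : T v = ∑ i : Fin 3, v i • T (EuclideanSpace.single i (1:ℝ)) := by
      conv_lhs => rw [← (EuclideanSpace.basisFun (Fin 3) ℝ).sum_repr v]
      rw [map_sum]
      refine Finset.sum_congr rfl fun i _ => ?_
      rw [map_smul, EuclideanSpace.basisFun_repr, EuclideanSpace.basisFun_apply]
    rw [hv]
    refine (norm_sum_le _ _).trans ?_
    have hcs := Real.sum_mul_le_sqrt_mul_sqrt (Finset.univ : Finset (Fin 3)) (fun i => |v i|)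
      (fun i => ‖T (EuclideanSpace.single i (1:ℝ))‖)
    have h1 : ∑ i : Fin 3, ‖v i • T (EuclideanSpace.single i (1:ℝ))‖ =
        ∑ i : Fin 3, |v i| * ‖T (EuclideanSpace.single i (1:ℝ))‖ := by
      refine Finset.sum_congr rfl fun i _ => ?_
      rw [norm_smul, Real.norm_eq_abs]
    rw [h1]
    refine hcs.trans (le_of_eq ?_)
    have h2 : Real.sqrt (∑ i : Fin 3, |v i| ^ 2) = ‖v‖ := by
      simp only [EuclideanSpace.norm_eq, Real.norm_eq_abs]
    rw [h2, mul_comm]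
  nlinarith [Real.sq_sqrt hD0, norm_nonneg T, Real.sqrt_nonneg (∑ i : Fin 3, ‖T (EuclideanSpace.single i (1:ℝ))‖ ^ 2)]

/-- **`L²` bound of an operator field by the integral of the density**: `‖G‖_{L²(S)} ≤ (∫_S Σ_i‖G e_i‖²)^{1∕2}`. [folklore] -/
theorem eLpNorm_le_sqrt_integral_dens {F : Type*} [NormedAddCommGroup F] [InnerProductSpace ℝ F]
    {S : Set (EuclideanSpace ℝ (Fin 3))} {G : EuclideanSpace ℝ (Fin 3) → EuclideanSpace ℝ (Fin 3) →L[ℝ] F}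
    (hGi : IntegrableOn (fun x => ∑ i : Fin 3, ‖G x (EuclideanSpace.single i (1:ℝ))‖ ^ 2) S volume) :
    eLpNorm G 2 (volume.restrict S) ≤
      (ENNReal.ofReal (∫ x in S, ∑ i : Fin 3, ‖G x (EuclideanSpace.single i (1:ℝ))‖ ^ 2)) ^ ((1:ℝ) / 2) := by
  rw [eLpNorm_eq_lintegral_rpow_enorm_toReal two_ne_zero ENNReal.ofNat_ne_top, ENNReal.toReal_ofNat]
  refine ENNReal.rpow_le_rpow ?_ (by norm_num)
  rw [ofReal_integral_eq_lintegral_ofReal hGi (Filter.Eventually.of_forall fun x =>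
    Finset.sum_nonneg fun i _ => sq_nonneg _)]
  refine lintegral_mono fun x => ?_
  have h1 : (‖G x‖ₑ : ℝ≥0∞) ^ (2:ℝ) = ENNReal.ofReal (‖G x‖ ^ 2) := by
    rw [← ofReal_norm, ENNReal.ofReal_rpow_of_nonneg (norm_nonneg _) (by norm_num : (0:ℝ) ≤ 2), Real.rpow_two]
  rw [h1]
  exact ENNReal.ofReal_le_ofReal (opNorm_sq_le_dens (G x))

/-! ## §2 Strong `L²(Q)` limit with a unit representative -/

/-- ★★ **STRONG `L²(Q)` SUBSEQUENTIAL LIMIT OF UNIT MAPS WITH BOUNDED ENERGY, UNIT EVERYWHERE.**  For unit maps `u_j` on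
the open unit cube `Q` with weak gradients of energy `≤ Λ`: a subsequence `φ`, a measurable `U` with `‖U‖ = 1`
EVERYWHERE, `u_{φ j} → U` a.e. on `Q` and `∫_Q ‖u_{φ j} − U‖² → 0`. [cite: Evans2010, §5.7 Theorem 1] -/
theorem exists_subseq_unit_limit (hQ : IsOpen {x : EuclideanSpace ℝ (Fin 3) | ∀ i : Fin 3, |x i| < 1})
    (u : ℕ → EuclideanSpace ℝ (Fin 3) → EuclideanSpace ℝ (Fin 4))
    (Gs : ℕ → EuclideanSpace ℝ (Fin 3) → (EuclideanSpace ℝ (Fin 3) →L[ℝ] EuclideanSpace ℝ (Fin 4))) (Λ : ℝ)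
    (hu : ∀ j, HasWeakFDerivOn ⟨{x : EuclideanSpace ℝ (Fin 3) | ∀ i : Fin 3, |x i| < 1}, hQ⟩ volume (u j) (Gs j))
    (hu1 : ∀ j (x : EuclideanSpace ℝ (Fin 3)), (∀ i : Fin 3, |x i| < 1) → ‖u j x‖ = 1)
    (hGi : ∀ j, IntegrableOn (fun x => ∑ i : Fin 3, ‖Gs j x (EuclideanSpace.single i (1:ℝ))‖ ^ 2)
      {x : EuclideanSpace ℝ (Fin 3) | ∀ i : Fin 3, |x i| < 1} volume)
    (hΛ : ∀ j, ∫ x in {x : EuclideanSpace ℝ (Fin 3) | ∀ i : Fin 3, |x i| < 1},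
      ∑ i : Fin 3, ‖Gs j x (EuclideanSpace.single i (1:ℝ))‖ ^ 2 ≤ Λ) :
    ∃ (U : EuclideanSpace ℝ (Fin 3) → EuclideanSpace ℝ (Fin 4)) (φ : ℕ → ℕ), StrictMono φ ∧ Measurable U ∧
      (∀ x, ‖U x‖ = 1) ∧
      (∀ᵐ x ∂(volume.restrict {x : EuclideanSpace ℝ (Fin 3) | ∀ i : Fin 3, |x i| < 1}),
        Tendsto (fun j => u (φ j) x) atTop (𝓝 (U x))) ∧
      Tendsto (fun j => ∫ x in {x : EuclideanSpace ℝ (Fin 3) | ∀ i : Fin 3, |x i| < 1}, ‖u (φ j) x - U x‖ ^ 2)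
        atTop (𝓝 0) := by
  set Q : Set (EuclideanSpace ℝ (Fin 3)) := {x | ∀ i : Fin 3, |x i| < 1} with hQdef
  have hQm : MeasurableSet Q := hQ.measurableSet
  have hQfin : volume Q < ⊤ := volume_openCube_lt_top
  haveI : IsFiniteMeasure (volume.restrict Q) := isFiniteMeasure_restrict.2 hQfin.ne
  -- `L²` bound of the gradients
  have hΛ0 : 0 ≤ Λ := le_trans (setIntegral_nonneg hQm fun x _ => Finset.sum_nonneg fun i _ => sq_nonneg _) (hΛ 0)
  have hGΛ : ∀ j, eLpNorm (Gs j) 2 (volume.restrict Q) ≤ (ENNReal.ofReal Λ) ^ ((1:ℝ) / 2) := fun j =>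
    (eLpNorm_le_sqrt_integral_dens (hGi j)).trans (ENNReal.rpow_le_rpow (ENNReal.ofReal_le_ofReal (hΛ j)) (by norm_num))
  -- (C-a2)
  obtain ⟨U₀, φ, hφ, hU₀, hL2, hae⟩ := exists_subseq_tendsto_eLpNorm_of_weakGrad (μ := volume)
    (Ω := ⟨Q, hQ⟩) hQfin hu (B := 1) (fun j x hx => (hu1 j x hx).le)
    (ENNReal.rpow_ne_top_of_nonneg (by norm_num) ENNReal.ofReal_ne_top) hGΛ
  -- the limit is unit a.e.; choose a unit representative
  have hU₀1 : ∀ᵐ x ∂(volume.restrict Q), ‖U₀ x‖ = 1 := by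
    filter_upwards [hae, ae_restrict_mem hQm] with x hx hxQ
    have h1 : Tendsto (fun j => ‖u (φ j) x‖) atTop (𝓝 ‖U₀ x‖) := hx.norm
    have h2 : Tendsto (fun j => ‖u (φ j) x‖) atTop (𝓝 1) := by
      simp only [hu1 _ x hxQ]; exact tendsto_const_nhds
    exact tendsto_nhds_unique h1 h2
  obtain ⟨U, hUm, hU1, hUU₀⟩ := exists_unit_representative U₀ hU₀.aestronglyMeasurable hU₀1
  have hae' : ∀ᵐ x ∂(volume.restrict Q), Tendsto (fun j => u (φ j) x) atTop (𝓝 (U x)) := by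
    filter_upwards [hae, hUU₀] with x hx hxU
    rwa [hxU]
  refine ⟨U, φ, hφ, hUm, hU1, hae', ?_⟩
  -- dominated convergence for `∫_Q ‖u_{φ j} − U‖²`
  have hmeas : ∀ j, AEStronglyMeasurable (u j) (volume.restrict Q) :=
    fun j => (hu j).locallyIntegrableOn.aestronglyMeasurable
  have hlim := tendsto_integral_of_dominated_convergence (μ := volume.restrict Q) (bound := fun _ => (4 : ℝ))
    (F := fun j x => ‖u (φ j) x - U x‖ ^ 2) (f := fun _ => (0 : ℝ))
    (fun j => (((hmeas (φ j)).sub hUm.aestronglyMeasurable).norm.pow 2))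
    (integrable_const _) (fun j => ?_) ?_
  · simpa using hlim
  · filter_upwards [ae_restrict_mem hQm] with x hx
    rw [Real.norm_eq_abs, abs_of_nonneg (sq_nonneg _)]
    have h1 : ‖u (φ j) x - U x‖ ≤ 2 := by
      calc ‖u (φ j) x - U x‖ ≤ ‖u (φ j) x‖ + ‖U x‖ := norm_sub_le _ _
        _ = 2 := by rw [hu1 _ x hx, hU1 x]; norm_num
    nlinarith [norm_nonneg (u (φ j) x - U x)]
  · filter_upwards [hae'] with x hx
    have h1 : Tendsto (fun j => ‖u (φ j) x - U x‖) atTop (𝓝 0) := by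
      have h2 := (hx.sub (tendsto_const_nhds (x := U x))).norm
      simpa using h2
    simpa using h1.pow 2

/-! ## §3 Letters for the weak gradient of the limit -/

/-- **Inner products of square-integrable fields are integrable** (`|⟪f,g⟫| ≤ (‖f‖² + ‖g‖²)/2`). [folklore] -/
theorem integrable_real_inner_of_sq {X : Type*} [MeasurableSpace X] {ν : Measure X}
    {f g : X → EuclideanSpace ℝ (Fin 4)} (hf : AEStronglyMeasurable f ν) (hg : AEStronglyMeasurable g ν)
    (hf2 : Integrable (fun x => ‖f x‖ ^ 2) ν) (hg2 : Integrable (fun x => ‖g x‖ ^ 2) ν) :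
    Integrable (fun x => ⟪f x, g x⟫) ν := by
  refine Integrable.mono' ((hf2.add hg2).div_const 2) (hf.inner hg) (Eventually.of_forall fun x => ?_)
  rw [Real.norm_eq_abs]
  have h1 := abs_real_inner_le_norm (f x) (g x)
  have h2 : ‖f x‖ * ‖g x‖ ≤ (‖f x‖ ^ 2 + ‖g x‖ ^ 2) / 2 := by nlinarith [sq_nonneg (‖f x‖ - ‖g x‖)]
  simpa only [Pi.add_apply] using h1.trans h2

/-- **Strong `L²` convergence passes bounded scalar weights to the limit**: if `∫_S ‖w_k − U‖² → 0` on a set of finite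
volume, `‖w_k‖, ‖U‖ ≤ 1`, and `|c| ≤ C`, then `∫_S c • w_k → ∫_S c • U`. [folklore] -/
theorem tendsto_setIntegral_smul_of_sq {S : Set (EuclideanSpace ℝ (Fin 3))} (hS : volume S < ⊤) (hSm : MeasurableSet S)
    {c : EuclideanSpace ℝ (Fin 3) → ℝ} {C : ℝ} (hcm : AEStronglyMeasurable c (volume.restrict S)) (hcC : ∀ x, |c x| ≤ C)
    {w : ℕ → EuclideanSpace ℝ (Fin 3) → EuclideanSpace ℝ (Fin 4)} {U : EuclideanSpace ℝ (Fin 3) → EuclideanSpace ℝ (Fin 4)}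
    (hwm : ∀ k, AEStronglyMeasurable (w k) (volume.restrict S)) (hUm : AEStronglyMeasurable U (volume.restrict S))
    (hw1 : ∀ k x, x ∈ S → ‖w k x‖ ≤ 1) (hU1 : ∀ x, ‖U x‖ ≤ 1)
    (h2 : Tendsto (fun k => ∫ x in S, ‖w k x - U x‖ ^ 2) atTop (𝓝 0)) :
    Tendsto (fun k => ∫ x in S, c x • w k x) atTop (𝓝 (∫ x in S, c x • U x)) := by
  haveI : IsFiniteMeasure (volume.restrict S) := isFiniteMeasure_restrict.2 hS.ne
  have hd2 : ∀ k, ∀ᵐ x ∂(volume.restrict S), ‖w k x - U x‖ ≤ 2 := fun k => by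
    filter_upwards [ae_restrict_mem hSm] with x hx
    calc ‖w k x - U x‖ ≤ ‖w k x‖ + ‖U x‖ := norm_sub_le _ _
      _ ≤ 1 + 1 := add_le_add (hw1 k x hx) (hU1 x)
      _ = 2 := by norm_num
  have h1 : Tendsto (fun k => ∫ x in S, ‖w k x - U x‖) atTop (𝓝 0) :=
    tendsto_setIntegral_norm_of_sq hS (fun k => (hwm k).sub hUm) hd2 h2
  have hC : ∀ x, |c x| ≤ |C| := fun x => (hcC x).trans (le_abs_self C)
  have hIw : ∀ k, Integrable (fun x => c x • w k x) (volume.restrict S) := fun k =>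
    integrable_of_norm_le (hcm.smul (hwm k)) (|C| * 1) (by
      filter_upwards [ae_restrict_mem hSm] with x hx
      rw [norm_smul, Real.norm_eq_abs]
      exact mul_le_mul (hC x) (hw1 k x hx) (norm_nonneg _) (abs_nonneg _))
  have hIU : Integrable (fun x => c x • U x) (volume.restrict S) :=
    integrable_of_norm_le (hcm.smul hUm) (|C| * 1) (Eventually.of_forall fun x => by
      rw [norm_smul, Real.norm_eq_abs]
      exact mul_le_mul (hC x) (hU1 x) (norm_nonneg _) (abs_nonneg _))
  have hId : ∀ k, Integrable (fun x => ‖w k x - U x‖) (volume.restrict S) := fun k =>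
    integrable_of_norm_le ((hwm k).sub hUm).norm 2 (by
      filter_upwards [hd2 k] with x hx; rwa [norm_norm])
  rw [tendsto_iff_norm_sub_tendsto_zero]
  refine squeeze_zero (fun k => norm_nonneg _) (fun k => ?_) (by simpa using h1.const_mul |C|)
  rw [← integral_sub (hIw k) hIU]
  calc ‖∫ x in S, (c x • w k x - c x • U x)‖ ≤ ∫ x in S, |C| * ‖w k x - U x‖ :=
        norm_integral_le_of_norm_le ((hId k).const_mul _) (Eventually.of_forall fun x => by
          rw [← smul_sub, norm_smul, Real.norm_eq_abs]
          exact mul_le_mul_of_nonneg_right (hC x) (norm_nonneg _))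
    _ = |C| * ∫ x in S, ‖w k x - U x‖ := integral_const_mul _ _

end Summit.QuantumFields.YangMills.Theorems.PoincareLipschitzSobolevCubeExtractionLetters

end
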